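import Summits.Ventures.Crystal3D.Theorems.StickyWulffConstantGenericWallFloorBarlowRowTopFamily
import Summits.Ventures.Crystal3D.Theorems.StickyWulffConstantGenericWallFloorBarlowFamiliesCount
import HarnessLib

/-!
# Row F4 core: the ROW|ROW and the two mixed ROW|ZIGZAG corners of a Barlow|Barlow wall cell are paid by the payers —
# `#T₁ + #T₂ ≤ Σ_PAY (12 − deg)` (crux `GenericWallFloor`, stmt-Ventures-19480, line `WallLedgerG`; lane T's row corner, (xxxvii⁗))

HONEST FRAMING. Venture `Summits/Ventures/Crystal3D` (cell `crystal3d-full`), helper `--supports` the crux `GenericWallFloor`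
(stmt-Ventures-19480) of `route-Ventures-StickyWulffConstant`, registered line `WallLedgerG`, open stub `stub_twoSlabAdhesion`.
Rung credit only; F-C1 not moved; NOT the stub.  Inputs BY NAME: E1 (`ExactOnly`), `DoubleStarCoaxialAt`, `CapPairCoaxial`
(both from `StarPairFar`), and the OFF-REGISTRY hypotheses (each reach set misses the other plate's stacking; the two reach sets are
disjoint).  Mirror of `barlowFamilies_card_le_payers` (the ZIG|ZIG corner, p650317) for the three remaining corners of lane T's
`MixFluxDominated` split (cf-p1 DECISION (xxxvii⁗)): a plate contributes either its ZIGZAG window family (`bottomFamily_spec` /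
`topFamily_spec`, walk data of `…BarlowPrefix`) or its ROW crossing family on the «++» c-LAYERS (`rowBottomFamily_spec` /
`rowTopFamily_spec`, row direction `r = α u + β v` steep for the plate's inward vertical); the count is `walkerFamilies_card_le_payers`.
* **`barlowRowRow_card_le_payers`**, **`barlowRowZig_card_le_payers`** (bottom rows, top zigzags),
  **`barlowZigRow_card_le_payers`** (bottom zigzags, top rows).
WHAT REMAINS for lane T: the identification of the families with the per-strip window-row sets of `RowSplitDefs` v3 and the rim /
`C_w` bookkeeping (row analogue of `…BarlowLineCount`).  F-C1 not moved.
-/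

noncomputable section

namespace Summit.Ventures.Crystal3D.Theorems

open Finset
open Literature.MathematicalPhysics.StatisticalMechanics
open Summit.Ventures.Crystal3D.Cruxes.TextureLiminf.TexShadow (stacking)
open scoped InnerProductSpace

variable {X : Finset (EuclideanSpace ℝ (Fin 3))}

section Cell

variable (hX : ∀ p ∈ X, ∀ q ∈ X, p ≠ q → 1 ≤ dist p q)
  {sE : EuclideanSpace ℝ (Fin 3)} (hsE : sE ∈ fccSlots) (hcert : ExactOnly 0 (fccSlots.filter fun w => 0 < ⟪w, sE⟫_ℝ))
  (hDS : ∀ F₁ F₂ : EuclideanSpace ℝ (Fin 3) ≃ₗᵢ[ℝ] EuclideanSpace ℝ (Fin 3), DoubleStarCoaxialAt F₁ F₂) (hCP : CapPairCoaxial)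
  -- the cell
  {σ₁ σ₂ : ℤ → ℤ} (hσ₁ : IsHaggSeq σ₁) (hσ₂ : IsHaggSeq σ₂)
  (L₁ L₂ : EuclideanSpace ℝ (Fin 3) ≃ₗᵢ[ℝ] EuclideanSpace ℝ (Fin 3)) (s₀ s₂ : EuclideanSpace ℝ (Fin 3))
  (R₀ h ρ : ℝ) (hR₀ : 6 ≤ R₀) (hh : 0 ≤ h) (hρ : 1 ≤ ρ) (P₁ P₂ : Finset (EuclideanSpace ℝ (Fin 3))) (hP₁X : P₁ ⊆ X) (hP₂X : P₂ ⊆ X)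
  (hcell : ∀ p ∈ X, -(2 * R₀) ≤ p 2 ∧ p 2 ≤ h + 2 * R₀ ∧ p 0 ^ 2 + p 1 ^ 2 ≤ ρ ^ 2)
  (hP₁ : ∀ p, p ∈ P₁ ↔ (p ∈ stacking L₁ s₀ σ₁ ∧ -(2 * R₀) ≤ p 2 ∧ p 2 ≤ -R₀ ∧ p 0 ^ 2 + p 1 ^ 2 ≤ ρ ^ 2))
  (hP₂ : ∀ p, p ∈ P₂ ↔ (p ∈ stacking L₂ s₂ σ₂ ∧ h + R₀ ≤ p 2 ∧ p 2 ≤ h + 2 * R₀ ∧ p 0 ^ 2 + p 1 ^ 2 ≤ ρ ^ 2))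

include hX hsE hcert hDS hCP hσ₁ hσ₂ hR₀ hh hρ hP₁X hP₂X hcell hP₁ hP₂

open scoped Classical in
/-- **ROW | ROW**: bottom rows along `L₁ r₁` (up), top rows along `L₂ r₂` (down), both on «++» c-layers; `#T₁ + #T₂ ≤ Σ_PAY (12 − deg)`. -/
theorem barlowRowRow_card_le_payers
    -- bottom row data (vertical e₃)
    {r₁ : EuclideanSpace ℝ (Fin 3)} (hr₁ : r₁ ∈ fccSlots) (α₁ β₁ : ℤ)
    (hr₁αβ : r₁ = (α₁ : ℝ) • triangularVec₁ 1 + (β₁ : ℝ) • triangularVec₂ 1)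
    (hsteep₁ : Real.sqrt 2 / 2 ≤ ⟪L₁ r₁, EuclideanSpace.single (2 : Fin 3) (1 : ℝ)⟫_ℝ)
    -- top row data (vertical −e₃)
    {r₂ : EuclideanSpace ℝ (Fin 3)} (hr₂ : r₂ ∈ fccSlots) (α₂ β₂ : ℤ)
    (hr₂αβ : r₂ = (α₂ : ℝ) • triangularVec₁ 1 + (β₂ : ℝ) • triangularVec₂ 1)
    (hsteep₂ : Real.sqrt 2 / 2 ≤ ⟪L₂ r₂, -EuclideanSpace.single (2 : Fin 3) (1 : ℝ)⟫_ℝ)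
    -- off-registry
    (hoff₁ : ∀ y ∈ reachSet L₁ (L₁ ((haggLabel σ₁ 0 : ℝ) • barlowOffset 1) + s₀)
      (insert (twinFrame L₁ (L₁ (EuclideanSpace.single (2 : Fin 3) (1 : ℝ))))
        (chainFrames (EuclideanSpace.single (2 : Fin 3) (1 : ℝ)) L₁ r₁)), y ∉ stacking L₂ s₂ σ₂)
    (hoff₂ : ∀ y ∈ reachSet L₂ (L₂ ((haggLabel σ₂ 0 : ℝ) • barlowOffset 1) + s₂)
      (insert (twinFrame L₂ (L₂ (EuclideanSpace.single (2 : Fin 3) (1 : ℝ))))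
        (chainFrames (-EuclideanSpace.single (2 : Fin 3) (1 : ℝ)) L₂ r₂)), y ∉ stacking L₁ s₀ σ₁)
    (hdisjR : ∀ y ∈ reachSet L₁ (L₁ ((haggLabel σ₁ 0 : ℝ) • barlowOffset 1) + s₀)
      (insert (twinFrame L₁ (L₁ (EuclideanSpace.single (2 : Fin 3) (1 : ℝ))))
        (chainFrames (EuclideanSpace.single (2 : Fin 3) (1 : ℝ)) L₁ r₁)),
      y ∉ reachSet L₂ (L₂ ((haggLabel σ₂ 0 : ℝ) • barlowOffset 1) + s₂)
        (insert (twinFrame L₂ (L₂ (EuclideanSpace.single (2 : Fin 3) (1 : ℝ))))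
          (chainFrames (-EuclideanSpace.single (2 : Fin 3) (1 : ℝ)) L₂ r₂)))
    -- the two crossing families
    (H₁ H₂ ρin : ℝ) (hH₁lo : -(2 * R₀) + 2 ≤ H₁) (hH₁hi : H₁ ≤ -R₀ - 3) (hH₂lo : -(h + 2 * R₀) + 2 ≤ H₂) (hH₂hi : H₂ ≤ -(h + R₀) - 3)
    (hρin : ρin + 8 / 3 * (h + 4 * R₀) + 2 ≤ ρ - 1)
    {ι₁ ι₂ : Type*} (T₁ : Finset ι₁) (T₂ : Finset ι₂) (m₁ a₁ b₁ : ι₁ → ℤ) (m₂ a₂ b₂ : ι₂ → ℤ)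
    (hcc₁ : ∀ i ∈ T₁, σ₁ (m₁ i) = 1 ∧ σ₁ (m₁ i - 1) = 1)
    (hlow₁ : ∀ i ∈ T₁, H₁ ≤ ⟪L₁ (barlowPos 1 (Real.sqrt (2 / 3)) σ₁ (m₁ i) (a₁ i) (b₁ i)) + s₀, EuclideanSpace.single (2 : Fin 3) (1 : ℝ)⟫_ℝ)
    (hpred₁ : ∀ i ∈ T₁, ⟪L₁ (barlowPos 1 (Real.sqrt (2 / 3)) σ₁ (m₁ i) (a₁ i - α₁) (b₁ i - β₁)) + s₀,
      EuclideanSpace.single (2 : Fin 3) (1 : ℝ)⟫_ℝ < H₁)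
    (hinjT₁ : ∀ i ∈ T₁, ∀ j ∈ T₁,
      barlowPos 1 (Real.sqrt (2 / 3)) σ₁ (m₁ i) (a₁ i) (b₁ i) = barlowPos 1 (Real.sqrt (2 / 3)) σ₁ (m₁ j) (a₁ j) (b₁ j) → i = j)
    (hlat₁ : ∀ i ∈ T₁, Real.sqrt ((L₁ (barlowPos 1 (Real.sqrt (2 / 3)) σ₁ (m₁ i) (a₁ i) (b₁ i)) + s₀) 0 ^ 2 +
      (L₁ (barlowPos 1 (Real.sqrt (2 / 3)) σ₁ (m₁ i) (a₁ i) (b₁ i)) + s₀) 1 ^ 2) ≤ ρin)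
    (hcc₂ : ∀ i ∈ T₂, σ₂ (m₂ i) = 1 ∧ σ₂ (m₂ i - 1) = 1)
    (hlow₂ : ∀ i ∈ T₂, H₂ ≤ ⟪L₂ (barlowPos 1 (Real.sqrt (2 / 3)) σ₂ (m₂ i) (a₂ i) (b₂ i)) + s₂, -EuclideanSpace.single (2 : Fin 3) (1 : ℝ)⟫_ℝ)
    (hpred₂ : ∀ i ∈ T₂, ⟪L₂ (barlowPos 1 (Real.sqrt (2 / 3)) σ₂ (m₂ i) (a₂ i - α₂) (b₂ i - β₂)) + s₂,
      -EuclideanSpace.single (2 : Fin 3) (1 : ℝ)⟫_ℝ < H₂)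
    (hinjT₂ : ∀ i ∈ T₂, ∀ j ∈ T₂,
      barlowPos 1 (Real.sqrt (2 / 3)) σ₂ (m₂ i) (a₂ i) (b₂ i) = barlowPos 1 (Real.sqrt (2 / 3)) σ₂ (m₂ j) (a₂ j) (b₂ j) → i = j)
    (hlat₂ : ∀ i ∈ T₂, Real.sqrt ((L₂ (barlowPos 1 (Real.sqrt (2 / 3)) σ₂ (m₂ i) (a₂ i) (b₂ i)) + s₂) 0 ^ 2 +
      (L₂ (barlowPos 1 (Real.sqrt (2 / 3)) σ₂ (m₂ i) (a₂ i) (b₂ i)) + s₂) 1 ^ 2) ≤ ρin)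
    -- fuel
    {N : ℕ} (hN : 8 * (h + 4 * R₀) < 3 * (N : ℝ)) :
    (T₁.card : ℝ) + T₂.card ≤
      ∑ y ∈ X.filter (fun y => (X.filter fun q => dist y q = 1).card ≠ 12 ∧ -R₀ - 2 ≤ y 2 ∧ y 2 ≤ h + R₀ + 2),
        ((12 : ℝ) - ((X.filter fun q => dist y q = 1).card : ℝ)) := by
  set e₃ : EuclideanSpace ℝ (Fin 3) := EuclideanSpace.single (2 : Fin 3) (1 : ℝ) with he₃
  have he₃n : ‖e₃‖ = 1 := by rw [he₃, PiLp.norm_single, norm_one]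
  have hztn : ‖-e₃‖ = 1 := by rw [norm_neg, he₃n]
  have he₃i : ∀ d : EuclideanSpace ℝ (Fin 3), ⟪d, e₃⟫_ℝ = d 2 := fun d => by rw [he₃, EuclideanSpace.inner_single_right]; simp
  obtain ⟨hB, hinjB⟩ := rowBottomFamily_spec σ₁ L₁ s₀ hσ₁ hX hsE hcert hσ₂ L₂ s₂ R₀ h ρ hR₀ hh hρ P₁ P₂ hP₁X hP₂X hcell hP₁ hP₂
    hr₁ α₁ β₁ hr₁αβ hsteep₁ hoff₁ H₁ ρin hH₁lo hH₁hi hρin T₁ m₁ a₁ b₁ hcc₁ hlow₁ hpred₁ hinjT₁ hlat₁ hN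
  obtain ⟨hT, hinjT⟩ := rowTopFamily_spec σ₂ L₂ s₂ hσ₂ hX hsE hcert hσ₁ L₁ s₀ R₀ h ρ hR₀ hh hρ P₁ P₂ hP₁X hP₂X hcell hP₁ hP₂
    hr₂ α₂ β₂ hr₂αβ hsteep₂ hoff₂ H₂ ρin hH₂lo hH₂hi hρin T₂ m₂ a₂ b₂ hcc₂ hlow₂ hpred₂ hinjT₂ hlat₂ hN
  set st₁ : ι₁ → EuclideanSpace ℝ (Fin 3) × List WalkEntry :=
    fun i => (L₁ (barlowPos 1 (Real.sqrt (2 / 3)) σ₁ (m₁ i) (a₁ i) (b₁ i)) + s₀, [⟨L₁, r₁, 0⟩]) with hst₁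
  set st₂ : ι₂ → EuclideanSpace ℝ (Fin 3) × List WalkEntry :=
    fun i => (L₂ (barlowPos 1 (Real.sqrt (2 / 3)) σ₂ (m₂ i) (a₂ i) (b₂ i)) + s₂, [⟨L₂, r₂, 0⟩]) with hst₂
  have hH₁ : ∀ q ∈ X, ⟪q, e₃⟫_ℝ ≤ h + 2 * R₀ := fun q hq => by rw [he₃i]; exact (hcell q hq).2.1
  have hH₂ : ∀ q ∈ X, ⟪q, -e₃⟫_ℝ ≤ 2 * R₀ := fun q hq => by rw [inner_neg_right, he₃i]; linarith [(hcell q hq).1]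
  refine walkerFamilies_card_le_payers hX hsE hcert hDS hCP he₃n hztn hH₁ hH₂ T₁ T₂ st₁ st₂ (b₁ := ⟨L₁, r₁, 0⟩) (b₂ := ⟨L₂, r₂, 0⟩) N
    (fun t ht => ?_) (fun t ht => ?_) hinjB hinjT _ (fun t ht => (hB t ht).2.2.2.2.2.1) (fun t ht => (hT t ht).2.2.2.2.2.1)
    (fun t ht t' ht' heq => ?_)
  · obtain ⟨hI, hW, hl, hC, hf, -, -⟩ := hB t ht
    exact ⟨hI, hW, hl, hC, hf⟩
  · obtain ⟨hI, hW, hl, hC, hf, -, -⟩ := hT t ht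
    exact ⟨hI, hW, hl, hC, hf⟩
  · exact hdisjR _ (hB t ht).2.2.2.2.2.2 (heq ▸ (hT t' ht').2.2.2.2.2.2)

open scoped Classical in
/-- **ROW | ZIGZAG**: bottom rows along `L₁ r₁` (up, «++» c-layers), top ZIGZAG family (walk data of `…BarlowPrefix`, vertical `−e₃`);
`#T₁ + #T₂ ≤ Σ_PAY (12 − deg)`. -/
theorem barlowRowZig_card_le_payers
    -- bottom row data (vertical e₃)
    {r₁ : EuclideanSpace ℝ (Fin 3)} (hr₁ : r₁ ∈ fccSlots) (α₁ β₁ : ℤ)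
    (hr₁αβ : r₁ = (α₁ : ℝ) • triangularVec₁ 1 + (β₁ : ℝ) • triangularVec₂ 1)
    (hsteep₁ : Real.sqrt 2 / 2 ≤ ⟪L₁ r₁, EuclideanSpace.single (2 : Fin 3) (1 : ℝ)⟫_ℝ)
    -- top walk data (vertical −e₃)
    (v₂ : EuclideanSpace ℝ (Fin 3)) (canon₂ : ℤ → EuclideanSpace ℝ (Fin 3) → EuclideanSpace ℝ (Fin 3) × List WalkEntry)
    (ms₂ : ℤ → EuclideanSpace ℝ (Fin 3))
    (hv₂ : v₂ ∈ fccSlots) (hv₂2 : v₂ 2 = Real.sqrt (2 / 3))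
    (hsteep₂ : Real.sqrt 2 / 2 ≤ ⟪L₂ v₂, -EuclideanSpace.single (2 : Fin 3) (1 : ℝ)⟫_ℝ)
    (hcanon₂₁ : ∀ m t, σ₂ (m - 1) = 1 → canon₂ m t = (t, [⟨L₂, v₂, 0⟩]))
    (hcanon₂₂ : ∀ m t, σ₂ (m - 1) = -1 → canon₂ m t =
      (t, [⟨twinFrame L₂ (L₂ (EuclideanSpace.single (2 : Fin 3) (1 : ℝ))),
            bestCapper (twinFrame L₂ (L₂ (EuclideanSpace.single (2 : Fin 3) (1 : ℝ)))) (L₂ (EuclideanSpace.single (2 : Fin 3) (1 : ℝ)))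
              (-EuclideanSpace.single (2 : Fin 3) (1 : ℝ)),
            L₂ (EuclideanSpace.single (2 : Fin 3) (1 : ℝ))⟩, ⟨L₂, v₂, 0⟩]))
    (hms₂₁ : ∀ m, σ₂ m = 1 → ms₂ m = v₂)
    (hms₂₂ : ∀ m, σ₂ m = -1 → ms₂ m =
      basalMirror (bestCapper (twinFrame L₂ (L₂ (EuclideanSpace.single (2 : Fin 3) (1 : ℝ)))) (L₂ (EuclideanSpace.single (2 : Fin 3) (1 : ℝ)))
        (-EuclideanSpace.single (2 : Fin 3) (1 : ℝ))))
    {δ₂ : ℝ} (hδ₂0 : 0 < δ₂) (hδ₂ : ∀ m, δ₂ ≤ ⟪L₂ (ms₂ m), -EuclideanSpace.single (2 : Fin 3) (1 : ℝ)⟫_ℝ)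
    -- off-registry
    (hoff₁ : ∀ y ∈ reachSet L₁ (L₁ ((haggLabel σ₁ 0 : ℝ) • barlowOffset 1) + s₀)
      (insert (twinFrame L₁ (L₁ (EuclideanSpace.single (2 : Fin 3) (1 : ℝ))))
        (chainFrames (EuclideanSpace.single (2 : Fin 3) (1 : ℝ)) L₁ r₁)), y ∉ stacking L₂ s₂ σ₂)
    (hoff₂ : ∀ y ∈ reachSet L₂ (L₂ ((haggLabel σ₂ 0 : ℝ) • barlowOffset 1) + s₂) (chainFrames (-EuclideanSpace.single (2 : Fin 3) (1 : ℝ)) L₂ v₂),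
      y ∉ stacking L₁ s₀ σ₁)
    (hdisjR : ∀ y ∈ reachSet L₁ (L₁ ((haggLabel σ₁ 0 : ℝ) • barlowOffset 1) + s₀)
      (insert (twinFrame L₁ (L₁ (EuclideanSpace.single (2 : Fin 3) (1 : ℝ))))
        (chainFrames (EuclideanSpace.single (2 : Fin 3) (1 : ℝ)) L₁ r₁)),
      y ∉ reachSet L₂ (L₂ ((haggLabel σ₂ 0 : ℝ) • barlowOffset 1) + s₂) (chainFrames (-EuclideanSpace.single (2 : Fin 3) (1 : ℝ)) L₂ v₂))
    -- the two families
    (H₁ H₂ ρin : ℝ) (hH₁lo : -(2 * R₀) + 2 ≤ H₁) (hH₁hi : H₁ ≤ -R₀ - 3) (hH₂lo : -(h + 2 * R₀) + 2 ≤ H₂) (hH₂hi : H₂ ≤ -(h + R₀) - 3)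
    (hρin₁ : ρin + 8 / 3 * (h + 4 * R₀) + 2 ≤ ρ - 1)
    (hρin₂ : ρin + 8 / 3 * (h + 4 * R₀) + ((-(h + R₀) - 2 - H₂) / δ₂ + 2) ≤ ρ - 1)
    {ι₁ ι₂ : Type*} (T₁ : Finset ι₁) (T₂ : Finset ι₂) (m₁ a₁ b₁ : ι₁ → ℤ) (m₂ a₂ b₂ : ι₂ → ℤ)
    (hcc₁ : ∀ i ∈ T₁, σ₁ (m₁ i) = 1 ∧ σ₁ (m₁ i - 1) = 1)
    (hlow₁ : ∀ i ∈ T₁, H₁ ≤ ⟪L₁ (barlowPos 1 (Real.sqrt (2 / 3)) σ₁ (m₁ i) (a₁ i) (b₁ i)) + s₀, EuclideanSpace.single (2 : Fin 3) (1 : ℝ)⟫_ℝ)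
    (hpred₁ : ∀ i ∈ T₁, ⟪L₁ (barlowPos 1 (Real.sqrt (2 / 3)) σ₁ (m₁ i) (a₁ i - α₁) (b₁ i - β₁)) + s₀,
      EuclideanSpace.single (2 : Fin 3) (1 : ℝ)⟫_ℝ < H₁)
    (hinjT₁ : ∀ i ∈ T₁, ∀ j ∈ T₁,
      barlowPos 1 (Real.sqrt (2 / 3)) σ₁ (m₁ i) (a₁ i) (b₁ i) = barlowPos 1 (Real.sqrt (2 / 3)) σ₁ (m₁ j) (a₁ j) (b₁ j) → i = j)
    (hlat₁ : ∀ i ∈ T₁, Real.sqrt ((L₁ (barlowPos 1 (Real.sqrt (2 / 3)) σ₁ (m₁ i) (a₁ i) (b₁ i)) + s₀) 0 ^ 2 +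
      (L₁ (barlowPos 1 (Real.sqrt (2 / 3)) σ₁ (m₁ i) (a₁ i) (b₁ i)) + s₀) 1 ^ 2) ≤ ρin)
    (hlow₂ : ∀ i ∈ T₂, H₂ ≤ ⟪L₂ (barlowPos 1 (Real.sqrt (2 / 3)) σ₂ (m₂ i) (a₂ i) (b₂ i)) + s₂, -EuclideanSpace.single (2 : Fin 3) (1 : ℝ)⟫_ℝ)
    (hpred₂ : ∀ i ∈ T₂, ⟪L₂ (barlowPos 1 (Real.sqrt (2 / 3)) σ₂ (m₂ i) (a₂ i) (b₂ i) - ms₂ (m₂ i - 1)) + s₂,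
      -EuclideanSpace.single (2 : Fin 3) (1 : ℝ)⟫_ℝ < H₂)
    (hinjT₂ : ∀ i ∈ T₂, ∀ j ∈ T₂,
      barlowPos 1 (Real.sqrt (2 / 3)) σ₂ (m₂ i) (a₂ i) (b₂ i) = barlowPos 1 (Real.sqrt (2 / 3)) σ₂ (m₂ j) (a₂ j) (b₂ j) → i = j)
    (hlat₂ : ∀ i ∈ T₂, Real.sqrt ((L₂ (barlowPos 1 (Real.sqrt (2 / 3)) σ₂ (m₂ i) (a₂ i) (b₂ i)) + s₂) 0 ^ 2 +
      (L₂ (barlowPos 1 (Real.sqrt (2 / 3)) σ₂ (m₂ i) (a₂ i) (b₂ i)) + s₂) 1 ^ 2) ≤ ρin)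
    -- fuel
    {N : ℕ} (hN₂ : ⌈(-(h + R₀) - 2 - H₂) / δ₂⌉₊ + 1 ≤ N) (hN : 8 * (h + 4 * R₀) < 3 * (N : ℝ)) :
    (T₁.card : ℝ) + T₂.card ≤
      ∑ y ∈ X.filter (fun y => (X.filter fun q => dist y q = 1).card ≠ 12 ∧ -R₀ - 2 ≤ y 2 ∧ y 2 ≤ h + R₀ + 2),
        ((12 : ℝ) - ((X.filter fun q => dist y q = 1).card : ℝ)) := by
  set e₃ : EuclideanSpace ℝ (Fin 3) := EuclideanSpace.single (2 : Fin 3) (1 : ℝ) with he₃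
  have he₃n : ‖e₃‖ = 1 := by rw [he₃, PiLp.norm_single, norm_one]
  have hztn : ‖-e₃‖ = 1 := by rw [norm_neg, he₃n]
  have he₃i : ∀ d : EuclideanSpace ℝ (Fin 3), ⟪d, e₃⟫_ℝ = d 2 := fun d => by rw [he₃, EuclideanSpace.inner_single_right]; simp
  obtain ⟨hB, hinjB⟩ := rowBottomFamily_spec σ₁ L₁ s₀ hσ₁ hX hsE hcert hσ₂ L₂ s₂ R₀ h ρ hR₀ hh hρ P₁ P₂ hP₁X hP₂X hcell hP₁ hP₂
    hr₁ α₁ β₁ hr₁αβ hsteep₁ hoff₁ H₁ ρin hH₁lo hH₁hi hρin₁ T₁ m₁ a₁ b₁ hcc₁ hlow₁ hpred₁ hinjT₁ hlat₁ hN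
  obtain ⟨hT, hinjT⟩ := topFamily_spec σ₂ L₂ s₂ v₂ canon₂ ms₂ hσ₂ hX hsE hcert hσ₁ L₁ s₀ R₀ h ρ hR₀ hh hρ P₁ P₂ hP₁X hP₂X hcell hP₁ hP₂
    hv₂ hv₂2 hsteep₂ hcanon₂₁ hcanon₂₂ hms₂₁ hms₂₂ hδ₂0 hδ₂ hoff₂ H₂ ρin hH₂lo hH₂hi hρin₂ T₂ m₂ a₂ b₂ hlow₂ hpred₂ hinjT₂ hlat₂ hN₂ hN
  set st₁ : ι₁ → EuclideanSpace ℝ (Fin 3) × List WalkEntry :=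
    fun i => (L₁ (barlowPos 1 (Real.sqrt (2 / 3)) σ₁ (m₁ i) (a₁ i) (b₁ i)) + s₀, [⟨L₁, r₁, 0⟩]) with hst₁
  set st₂ : ι₂ → EuclideanSpace ℝ (Fin 3) × List WalkEntry :=
    fun i => canon₂ (m₂ i) (L₂ (barlowPos 1 (Real.sqrt (2 / 3)) σ₂ (m₂ i) (a₂ i) (b₂ i)) + s₂) with hst₂
  have hH₁ : ∀ q ∈ X, ⟪q, e₃⟫_ℝ ≤ h + 2 * R₀ := fun q hq => by rw [he₃i]; exact (hcell q hq).2.1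
  have hH₂ : ∀ q ∈ X, ⟪q, -e₃⟫_ℝ ≤ 2 * R₀ := fun q hq => by rw [inner_neg_right, he₃i]; linarith [(hcell q hq).1]
  refine walkerFamilies_card_le_payers hX hsE hcert hDS hCP he₃n hztn hH₁ hH₂ T₁ T₂ st₁ st₂ (b₁ := ⟨L₁, r₁, 0⟩) (b₂ := ⟨L₂, v₂, 0⟩) N
    (fun t ht => ?_) (fun t ht => ?_) hinjB hinjT _ (fun t ht => (hB t ht).2.2.2.2.2.1) (fun t ht => (hT t ht).2.2.2.2.2.1)
    (fun t ht t' ht' heq => ?_)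
  · obtain ⟨hI, hW, hl, hC, hf, -, -⟩ := hB t ht
    exact ⟨hI, hW, hl, hC, hf⟩
  · obtain ⟨hI, hW, hl, hC, hf, -, -⟩ := hT t ht
    exact ⟨hI, hW, hl, hC, hf⟩
  · exact hdisjR _ (hB t ht).2.2.2.2.2.2 (heq ▸ (hT t' ht').2.2.2.2.2.2)

open scoped Classical in
/-- **ZIGZAG | ROW**: bottom ZIGZAG family (walk data of `…BarlowPrefix`, vertical `e₃`), top rows along `L₂ r₂` (down, «++» c-layers);
`#T₁ + #T₂ ≤ Σ_PAY (12 − deg)`. -/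
theorem barlowZigRow_card_le_payers
    -- bottom walk data (vertical e₃)
    (v₁ : EuclideanSpace ℝ (Fin 3)) (canon₁ : ℤ → EuclideanSpace ℝ (Fin 3) → EuclideanSpace ℝ (Fin 3) × List WalkEntry)
    (ms₁ : ℤ → EuclideanSpace ℝ (Fin 3))
    (hv₁ : v₁ ∈ fccSlots) (hv₁2 : v₁ 2 = Real.sqrt (2 / 3))
    (hsteep₁ : Real.sqrt 2 / 2 ≤ ⟪L₁ v₁, EuclideanSpace.single (2 : Fin 3) (1 : ℝ)⟫_ℝ)
    (hcanon₁₁ : ∀ m t, σ₁ (m - 1) = 1 → canon₁ m t = (t, [⟨L₁, v₁, 0⟩]))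
    (hcanon₁₂ : ∀ m t, σ₁ (m - 1) = -1 → canon₁ m t =
      (t, [⟨twinFrame L₁ (L₁ (EuclideanSpace.single (2 : Fin 3) (1 : ℝ))),
            bestCapper (twinFrame L₁ (L₁ (EuclideanSpace.single (2 : Fin 3) (1 : ℝ)))) (L₁ (EuclideanSpace.single (2 : Fin 3) (1 : ℝ)))
              (EuclideanSpace.single (2 : Fin 3) (1 : ℝ)),
            L₁ (EuclideanSpace.single (2 : Fin 3) (1 : ℝ))⟩, ⟨L₁, v₁, 0⟩]))
    (hms₁₁ : ∀ m, σ₁ m = 1 → ms₁ m = v₁)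
    (hms₁₂ : ∀ m, σ₁ m = -1 → ms₁ m =
      basalMirror (bestCapper (twinFrame L₁ (L₁ (EuclideanSpace.single (2 : Fin 3) (1 : ℝ)))) (L₁ (EuclideanSpace.single (2 : Fin 3) (1 : ℝ)))
        (EuclideanSpace.single (2 : Fin 3) (1 : ℝ))))
    {δ₁ : ℝ} (hδ₁0 : 0 < δ₁) (hδ₁ : ∀ m, δ₁ ≤ ⟪L₁ (ms₁ m), EuclideanSpace.single (2 : Fin 3) (1 : ℝ)⟫_ℝ)
    -- top row data (vertical −e₃)
    {r₂ : EuclideanSpace ℝ (Fin 3)} (hr₂ : r₂ ∈ fccSlots) (α₂ β₂ : ℤ)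
    (hr₂αβ : r₂ = (α₂ : ℝ) • triangularVec₁ 1 + (β₂ : ℝ) • triangularVec₂ 1)
    (hsteep₂ : Real.sqrt 2 / 2 ≤ ⟪L₂ r₂, -EuclideanSpace.single (2 : Fin 3) (1 : ℝ)⟫_ℝ)
    -- off-registry
    (hoff₁ : ∀ y ∈ reachSet L₁ (L₁ ((haggLabel σ₁ 0 : ℝ) • barlowOffset 1) + s₀) (chainFrames (EuclideanSpace.single (2 : Fin 3) (1 : ℝ)) L₁ v₁),
      y ∉ stacking L₂ s₂ σ₂)
    (hoff₂ : ∀ y ∈ reachSet L₂ (L₂ ((haggLabel σ₂ 0 : ℝ) • barlowOffset 1) + s₂)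
      (insert (twinFrame L₂ (L₂ (EuclideanSpace.single (2 : Fin 3) (1 : ℝ))))
        (chainFrames (-EuclideanSpace.single (2 : Fin 3) (1 : ℝ)) L₂ r₂)), y ∉ stacking L₁ s₀ σ₁)
    (hdisjR : ∀ y ∈ reachSet L₁ (L₁ ((haggLabel σ₁ 0 : ℝ) • barlowOffset 1) + s₀) (chainFrames (EuclideanSpace.single (2 : Fin 3) (1 : ℝ)) L₁ v₁),
      y ∉ reachSet L₂ (L₂ ((haggLabel σ₂ 0 : ℝ) • barlowOffset 1) + s₂)
        (insert (twinFrame L₂ (L₂ (EuclideanSpace.single (2 : Fin 3) (1 : ℝ))))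
          (chainFrames (-EuclideanSpace.single (2 : Fin 3) (1 : ℝ)) L₂ r₂)))
    -- the two families
    (H₁ H₂ ρin : ℝ) (hH₁lo : -(2 * R₀) + 2 ≤ H₁) (hH₁hi : H₁ ≤ -R₀ - 3) (hH₂lo : -(h + 2 * R₀) + 2 ≤ H₂) (hH₂hi : H₂ ≤ -(h + R₀) - 3)
    (hρin₁ : ρin + 8 / 3 * (h + 4 * R₀) + ((-R₀ - 2 - H₁) / δ₁ + 2) ≤ ρ - 1)
    (hρin₂ : ρin + 8 / 3 * (h + 4 * R₀) + 2 ≤ ρ - 1)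
    {ι₁ ι₂ : Type*} (T₁ : Finset ι₁) (T₂ : Finset ι₂) (m₁ a₁ b₁ : ι₁ → ℤ) (m₂ a₂ b₂ : ι₂ → ℤ)
    (hlow₁ : ∀ i ∈ T₁, H₁ ≤ ⟪L₁ (barlowPos 1 (Real.sqrt (2 / 3)) σ₁ (m₁ i) (a₁ i) (b₁ i)) + s₀, EuclideanSpace.single (2 : Fin 3) (1 : ℝ)⟫_ℝ)
    (hpred₁ : ∀ i ∈ T₁, ⟪L₁ (barlowPos 1 (Real.sqrt (2 / 3)) σ₁ (m₁ i) (a₁ i) (b₁ i) - ms₁ (m₁ i - 1)) + s₀,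
      EuclideanSpace.single (2 : Fin 3) (1 : ℝ)⟫_ℝ < H₁)
    (hinjT₁ : ∀ i ∈ T₁, ∀ j ∈ T₁,
      barlowPos 1 (Real.sqrt (2 / 3)) σ₁ (m₁ i) (a₁ i) (b₁ i) = barlowPos 1 (Real.sqrt (2 / 3)) σ₁ (m₁ j) (a₁ j) (b₁ j) → i = j)
    (hlat₁ : ∀ i ∈ T₁, Real.sqrt ((L₁ (barlowPos 1 (Real.sqrt (2 / 3)) σ₁ (m₁ i) (a₁ i) (b₁ i)) + s₀) 0 ^ 2 +
      (L₁ (barlowPos 1 (Real.sqrt (2 / 3)) σ₁ (m₁ i) (a₁ i) (b₁ i)) + s₀) 1 ^ 2) ≤ ρin)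
    (hcc₂ : ∀ i ∈ T₂, σ₂ (m₂ i) = 1 ∧ σ₂ (m₂ i - 1) = 1)
    (hlow₂ : ∀ i ∈ T₂, H₂ ≤ ⟪L₂ (barlowPos 1 (Real.sqrt (2 / 3)) σ₂ (m₂ i) (a₂ i) (b₂ i)) + s₂, -EuclideanSpace.single (2 : Fin 3) (1 : ℝ)⟫_ℝ)
    (hpred₂ : ∀ i ∈ T₂, ⟪L₂ (barlowPos 1 (Real.sqrt (2 / 3)) σ₂ (m₂ i) (a₂ i - α₂) (b₂ i - β₂)) + s₂,
      -EuclideanSpace.single (2 : Fin 3) (1 : ℝ)⟫_ℝ < H₂)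
    (hinjT₂ : ∀ i ∈ T₂, ∀ j ∈ T₂,
      barlowPos 1 (Real.sqrt (2 / 3)) σ₂ (m₂ i) (a₂ i) (b₂ i) = barlowPos 1 (Real.sqrt (2 / 3)) σ₂ (m₂ j) (a₂ j) (b₂ j) → i = j)
    (hlat₂ : ∀ i ∈ T₂, Real.sqrt ((L₂ (barlowPos 1 (Real.sqrt (2 / 3)) σ₂ (m₂ i) (a₂ i) (b₂ i)) + s₂) 0 ^ 2 +
      (L₂ (barlowPos 1 (Real.sqrt (2 / 3)) σ₂ (m₂ i) (a₂ i) (b₂ i)) + s₂) 1 ^ 2) ≤ ρin)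
    -- fuel
    {N : ℕ} (hN₁ : ⌈(-R₀ - 2 - H₁) / δ₁⌉₊ + 1 ≤ N) (hN : 8 * (h + 4 * R₀) < 3 * (N : ℝ)) :
    (T₁.card : ℝ) + T₂.card ≤
      ∑ y ∈ X.filter (fun y => (X.filter fun q => dist y q = 1).card ≠ 12 ∧ -R₀ - 2 ≤ y 2 ∧ y 2 ≤ h + R₀ + 2),
        ((12 : ℝ) - ((X.filter fun q => dist y q = 1).card : ℝ)) := by
  set e₃ : EuclideanSpace ℝ (Fin 3) := EuclideanSpace.single (2 : Fin 3) (1 : ℝ) with he₃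
  have he₃n : ‖e₃‖ = 1 := by rw [he₃, PiLp.norm_single, norm_one]
  have hztn : ‖-e₃‖ = 1 := by rw [norm_neg, he₃n]
  have he₃i : ∀ d : EuclideanSpace ℝ (Fin 3), ⟪d, e₃⟫_ℝ = d 2 := fun d => by rw [he₃, EuclideanSpace.inner_single_right]; simp
  obtain ⟨hB, hinjB⟩ := bottomFamily_spec σ₁ L₁ s₀ v₁ canon₁ ms₁ hσ₁ hX hsE hcert hσ₂ L₂ s₂ R₀ h ρ hR₀ hh hρ P₁ P₂ hP₁X hP₂X hcell hP₁ hP₂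
    hv₁ hv₁2 hsteep₁ hcanon₁₁ hcanon₁₂ hms₁₁ hms₁₂ hδ₁0 hδ₁ hoff₁ H₁ ρin hH₁lo hH₁hi hρin₁ T₁ m₁ a₁ b₁ hlow₁ hpred₁ hinjT₁ hlat₁ hN₁ hN
  obtain ⟨hT, hinjT⟩ := rowTopFamily_spec σ₂ L₂ s₂ hσ₂ hX hsE hcert hσ₁ L₁ s₀ R₀ h ρ hR₀ hh hρ P₁ P₂ hP₁X hP₂X hcell hP₁ hP₂
    hr₂ α₂ β₂ hr₂αβ hsteep₂ hoff₂ H₂ ρin hH₂lo hH₂hi hρin₂ T₂ m₂ a₂ b₂ hcc₂ hlow₂ hpred₂ hinjT₂ hlat₂ hN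
  set st₁ : ι₁ → EuclideanSpace ℝ (Fin 3) × List WalkEntry :=
    fun i => canon₁ (m₁ i) (L₁ (barlowPos 1 (Real.sqrt (2 / 3)) σ₁ (m₁ i) (a₁ i) (b₁ i)) + s₀) with hst₁
  set st₂ : ι₂ → EuclideanSpace ℝ (Fin 3) × List WalkEntry :=
    fun i => (L₂ (barlowPos 1 (Real.sqrt (2 / 3)) σ₂ (m₂ i) (a₂ i) (b₂ i)) + s₂, [⟨L₂, r₂, 0⟩]) with hst₂
  have hH₁ : ∀ q ∈ X, ⟪q, e₃⟫_ℝ ≤ h + 2 * R₀ := fun q hq => by rw [he₃i]; exact (hcell q hq).2.1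
  have hH₂ : ∀ q ∈ X, ⟪q, -e₃⟫_ℝ ≤ 2 * R₀ := fun q hq => by rw [inner_neg_right, he₃i]; linarith [(hcell q hq).1]
  refine walkerFamilies_card_le_payers hX hsE hcert hDS hCP he₃n hztn hH₁ hH₂ T₁ T₂ st₁ st₂ (b₁ := ⟨L₁, v₁, 0⟩) (b₂ := ⟨L₂, r₂, 0⟩) N
    (fun t ht => ?_) (fun t ht => ?_) hinjB hinjT _ (fun t ht => (hB t ht).2.2.2.2.2.1) (fun t ht => (hT t ht).2.2.2.2.2.1)
    (fun t ht t' ht' heq => ?_)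
  · obtain ⟨hI, hW, hl, hC, hf, -, -⟩ := hB t ht
    exact ⟨hI, hW, hl, hC, hf⟩
  · obtain ⟨hI, hW, hl, hC, hf, -, -⟩ := hT t ht
    exact ⟨hI, hW, hl, hC, hf⟩
  · exact hdisjR _ (hB t ht).2.2.2.2.2.2 (heq ▸ (hT t' ht').2.2.2.2.2.2)

end Cell

end Summit.Ventures.Crystal3D.Theorems

end
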